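import Mathlib
import HarnessLib

/-!
# HANDOFF — the secular equation has a root in EVERY ladder gap (cell rh-explicit, TRACK «HANDOFF», seat theory-2 gen11; FILE XII-x′,
# the existence half of interlacing; companion of `HandoffSecularPencil` (XII-x, p385944), which has the uniqueness half and the
# eigenvector)

HONEST FRAMING. Nothing here bears on the truth of RH; this is one-variable real analysis (the intermediate value theorem between two
poles). For a finite ladder `E : ι → ℝ`, couplings `a : ι → ℝ` and `s > 0`, the secular function `φ(λ) = s·Σ_k a_k²/(E_k − λ)` of the
rank-one pencil `diag(E) − s·a aᵀ` tends to `−∞` at the right of a live rung (`a_i ≠ 0`) and to `+∞` at the left of the next live rung,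
so `φ = 1` has a solution strictly inside every gap between consecutive live rungs (`exists_secular_root_in_gap`). With XII-x
(`eigen_of_secular`: such a root is an eigenvalue with eigenvector `a_k/(E_k − λ)`; `eigenvalue_in_gap_unique`: at most one per gap;
`not_eigen_above`: none above the top rung; `exists_neg_eigenvalue_iff`: one below the ladder iff the capacity exceeds 1) this is the
full INTERLACING statement the cell's data show (theory-2 gen11 census, DERIVED-CHECK: in 24/24 odd-sector cells of cc-s2-3's cc6-hp
records the block-Ritz values of the window form sit one per gap of the full form's near-null ladder, 72/72 gaps). The file is
self-contained (explicit sums, no import of XII-x) because XII-x has no farm olean yet. Folklore (Golub 1973; Bunch–Nielsen–Sorensen 1978).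
-/

set_option linter.dupNamespace false  -- the mandated namespace repeats `RiemannHypothesis`

open Finset

namespace Summit.RiemannHypothesis.RiemannHypothesis.Theorems.HandoffSecularGaps

variable {ι : Type*} [Fintype ι]

/-- Upper bound of the secular sum just to the right of the rung `E i`: at `λ = E i + t` with `0 < t ≤ m`, `2m ≤ E j − E i` and no rung
strictly between `E i` and `E j`, every term with `E k ≤ E i` is `≤ 0`, the `i`-term equals `−a_i²/t`, and every term with
`E j ≤ E k` is `≤ a_k²/m`; hence `Σ_k a_k²/(E_k − λ) ≤ −a_i²/t + (Σ_k a_k²)/m`. [folklore] -/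
theorem secular_sum_le_near_lower_pole [DecidableEq ι] {E a : ι → ℝ} {i j : ι} {t m : ℝ} (ht : 0 < t) (htm : t ≤ m)
    (hm : 2 * m ≤ E j - E i) (hgap : ∀ k, E k ≤ E i ∨ E j ≤ E k) :
    ∑ k, a k ^ 2 / (E k - (E i + t)) ≤ -(a i ^ 2 / t) + (∑ k, a k ^ 2) / m := by
  have hm0 : 0 < m := lt_of_lt_of_le ht htm
  rw [← Finset.add_sum_erase _ _ (Finset.mem_univ i), Finset.sum_div]
  have hi : a i ^ 2 / (E i - (E i + t)) = -(a i ^ 2 / t) := by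
    rw [show E i - (E i + t) = -t by ring, div_neg]
  rw [hi]
  refine add_le_add le_rfl ?_
  calc ∑ k ∈ univ.erase i, a k ^ 2 / (E k - (E i + t))
      ≤ ∑ k ∈ univ.erase i, a k ^ 2 / m := Finset.sum_le_sum fun k _ ↦ by
        rcases hgap k with hk | hk
        · exact le_trans (div_nonpos_of_nonneg_of_nonpos (sq_nonneg _) (by linarith)) (div_nonneg (sq_nonneg _) hm0.le)
        · exact div_le_div_of_nonneg_left (sq_nonneg _) hm0 (by linarith)
    _ ≤ ∑ k, a k ^ 2 / m := Finset.sum_le_univ_sum_of_nonneg fun k ↦ div_nonneg (sq_nonneg _) hm0.le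

/-- Lower bound of the secular sum just to the left of the rung `E j`: at `λ = E j − u` with `0 < u ≤ m`, `2m ≤ E j − E i` and no rung
strictly between, `Σ_k a_k²/(E_k − λ) ≥ a_j²/u − (Σ_k a_k²)/m`. [folklore] -/
theorem secular_sum_ge_near_upper_pole [DecidableEq ι] {E a : ι → ℝ} {i j : ι} {u m : ℝ} (hu : 0 < u) (hum : u ≤ m)
    (hm : 2 * m ≤ E j - E i) (hgap : ∀ k, E k ≤ E i ∨ E j ≤ E k) :
    a j ^ 2 / u - (∑ k, a k ^ 2) / m ≤ ∑ k, a k ^ 2 / (E k - (E j - u)) := by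
  have hm0 : 0 < m := lt_of_lt_of_le hu hum
  rw [← Finset.add_sum_erase _ (fun k ↦ a k ^ 2 / (E k - (E j - u))) (Finset.mem_univ j), Finset.sum_div]
  have hj : a j ^ 2 / (E j - (E j - u)) = a j ^ 2 / u := by
    rw [show E j - (E j - u) = u by ring]
  rw [hj, sub_eq_add_neg, ← Finset.sum_neg_distrib]
  refine add_le_add le_rfl ?_
  calc ∑ k, -(a k ^ 2 / m)
      ≤ ∑ k ∈ univ.erase j, -(a k ^ 2 / m) := by
        rw [← Finset.add_sum_erase _ (fun k ↦ -(a k ^ 2 / m)) (Finset.mem_univ j)]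
        have : -(a j ^ 2 / m) ≤ 0 := neg_nonpos.mpr (div_nonneg (sq_nonneg _) hm0.le)
        linarith
    _ ≤ ∑ k ∈ univ.erase j, a k ^ 2 / (E k - (E j - u)) := Finset.sum_le_sum fun k _ ↦ by
        rcases hgap k with hk | hk
        · -- E k ≤ E i: the denominator is ≤ -m < 0, so the term is ≥ -(a_k²/m)
          have h1 : a k ^ 2 / (-(E k - (E j - u))) ≤ a k ^ 2 / m :=
            div_le_div_of_nonneg_left (sq_nonneg _) hm0 (by linarith)
          have h2 : a k ^ 2 / (E k - (E j - u)) = -(a k ^ 2 / (-(E k - (E j - u)))) := by rw [div_neg, neg_neg]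
          rw [h2]
          exact neg_le_neg h1
        · exact le_trans (neg_nonpos.mpr (div_nonneg (sq_nonneg _) hm0.le))
            (div_nonneg (sq_nonneg _) (by linarith))

/-- The secular function is continuous on a closed interval that stays at distance from every rung: if each rung satisfies
`E k ≤ lo − t` or `hi + u ≤ E k` with `t, u > 0`, then `λ ↦ s·Σ_k a_k²/(E_k − λ)` is continuous on `[lo, hi]`. [folklore] -/
theorem continuousOn_secular_sum {E a : ι → ℝ} (s : ℝ) {lo hi t u : ℝ} (ht : 0 < t) (hu : 0 < u)
    (hfar : ∀ k, E k ≤ lo - t ∨ hi + u ≤ E k) :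
    ContinuousOn (fun lam ↦ s * ∑ k, a k ^ 2 / (E k - lam)) (Set.Icc lo hi) := by
  refine continuousOn_const.mul (continuousOn_finsetSum _ fun k _ ↦ ?_)
  refine continuousOn_const.div (continuousOn_const.sub continuousOn_id) fun lam hlam ↦ ?_
  obtain ⟨h1, h2⟩ := hlam
  rcases hfar k with hk | hk
  · have : E k - lam < 0 := by linarith
    exact this.ne
  · have : 0 < E k - lam := by linarith
    exact this.ne'

/-- **A SECULAR ROOT IN EVERY LADDER GAP.** Let `E i < E j` be consecutive live rungs — no rung strictly between them (`E k ≤ E i` or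
`E j ≤ E k` for every `k`; coincident rungs allowed), `a i ≠ 0`, `a j ≠ 0` — and `s > 0`. Then the secular equation
`s·Σ_k a_k²/(E_k − λ) = 1` of the rank-one pencil `diag(E) − s·a aᵀ` has a solution with `E i < λ < E j`. (The sum is `≤ −1` at
`E i + t` and `≥ 1` at `E j − u` for explicit small `t, u`, and continuous in between: intermediate value theorem.) With XII-x
(`HandoffSecularPencil.eigen_of_secular`, `eigenvalue_in_gap_unique`) the pencil has EXACTLY ONE eigenvalue in each such gap, with
eigenvector `a_k/(E_k − λ)`: the interlacing the cell's window-form sections show against the full form's near-null ladder.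
[folklore: Golub 1973; Bunch–Nielsen–Sorensen 1978] -/
theorem exists_secular_root_in_gap [DecidableEq ι] {E a : ι → ℝ} {s : ℝ} (hs : 0 < s) {i j : ι} (hij : E i < E j)
    (hgap : ∀ k, E k ≤ E i ∨ E j ≤ E k) (hi : a i ≠ 0) (hj : a j ≠ 0) :
    ∃ lam : ℝ, E i < lam ∧ lam < E j ∧ s * ∑ k, a k ^ 2 / (E k - lam) = 1 := by
  set m : ℝ := (E j - E i) / 2 with hm_def
  have hm0 : 0 < m := by rw [hm_def]; linarith
  have hm2 : 2 * m ≤ E j - E i := by rw [hm_def]; linarith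
  set A : ℝ := ∑ k, a k ^ 2 with hA_def
  have hA0 : 0 ≤ A := Finset.sum_nonneg fun k _ ↦ sq_nonneg (a k)
  have hai : 0 < a i ^ 2 := by positivity
  have haj : 0 < a j ^ 2 := by positivity
  set B : ℝ := s * A / m + 1 with hB_def
  have hB0 : 0 < B := by
    have : 0 ≤ s * A / m := div_nonneg (mul_nonneg hs.le hA0) hm0.le
    linarith
  set t : ℝ := min m (s * a i ^ 2 / B) with ht_def
  set u : ℝ := min m (s * a j ^ 2 / B) with hu_def
  have ht0 : 0 < t := lt_min hm0 (div_pos (mul_pos hs hai) hB0)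
  have hu0 : 0 < u := lt_min hm0 (div_pos (mul_pos hs haj) hB0)
  have htm : t ≤ m := min_le_left _ _
  have hum : u ≤ m := min_le_left _ _
  -- B ≤ s a_i²/t and B ≤ s a_j²/u
  have hBt : B ≤ s * a i ^ 2 / t := by
    rw [le_div_iff₀ ht0]
    have : t ≤ s * a i ^ 2 / B := min_le_right _ _
    rw [le_div_iff₀ hB0] at this
    linarith
  have hBu : B ≤ s * a j ^ 2 / u := by
    rw [le_div_iff₀ hu0]
    have : u ≤ s * a j ^ 2 / B := min_le_right _ _
    rw [le_div_iff₀ hB0] at this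
    linarith
  -- values at the two endpoints
  have hlow : s * ∑ k, a k ^ 2 / (E k - (E i + t)) ≤ -1 := by
    have h := secular_sum_le_near_lower_pole (a := a) ht0 htm hm2 hgap
    have h' : s * ∑ k, a k ^ 2 / (E k - (E i + t)) ≤ s * (-(a i ^ 2 / t) + A / m) := mul_le_mul_of_nonneg_left h hs.le
    have e : s * (-(a i ^ 2 / t) + A / m) = -(s * a i ^ 2 / t) + s * A / m := by ring
    rw [e] at h'
    linarith
  have hhigh : 1 ≤ s * ∑ k, a k ^ 2 / (E k - (E j - u)) := by
    have h := secular_sum_ge_near_upper_pole (a := a) hu0 hum hm2 hgap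
    have h' : s * (a j ^ 2 / u - A / m) ≤ s * ∑ k, a k ^ 2 / (E k - (E j - u)) := mul_le_mul_of_nonneg_left h hs.le
    have e : s * (a j ^ 2 / u - A / m) = s * a j ^ 2 / u - s * A / m := by ring
    rw [e] at h'
    linarith
  have hle : E i + t ≤ E j - u := by linarith
  have hcont : ContinuousOn (fun lam ↦ s * ∑ k, a k ^ 2 / (E k - lam)) (Set.Icc (E i + t) (E j - u)) := by
    refine continuousOn_secular_sum s ht0 hu0 fun k ↦ ?_
    rcases hgap k with hk | hk
    · exact Or.inl (by linarith)
    · exact Or.inr (by linarith)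
  have hmem : (1 : ℝ) ∈ Set.Icc (s * ∑ k, a k ^ 2 / (E k - (E i + t))) (s * ∑ k, a k ^ 2 / (E k - (E j - u))) :=
    ⟨by linarith, hhigh⟩
  obtain ⟨lam, ⟨h1, h2⟩, hval⟩ := intermediate_value_Icc hle hcont hmem
  exact ⟨lam, by linarith, by linarith, hval⟩

/-- Below the BOTTOM live rung there is a root iff the capacity exceeds one (XII-x `exists_neg_secular_root_iff` gives the negative
root; here the general form): if `E i` is the lowest rung (`E i ≤ E k` for all `k`), `a i ≠ 0`, `s > 0` and `s·Σ a_k²/(E_k − λ₀) ≤ 1`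
at some `λ₀ < E i`, then there is a root in `[λ₀, E i)`. [folklore] -/
theorem exists_secular_root_below_bottom [DecidableEq ι] {E a : ι → ℝ} {s lam0 : ℝ} (hs : 0 < s) {i : ι}
    (hbot : ∀ k, E i ≤ E k) (hi : a i ≠ 0) (hlam0 : lam0 < E i) (hval0 : s * ∑ k, a k ^ 2 / (E k - lam0) ≤ 1) :
    ∃ lam : ℝ, lam0 ≤ lam ∧ lam < E i ∧ s * ∑ k, a k ^ 2 / (E k - lam) = 1 := by
  set m : ℝ := (E i - lam0) / 2 with hm_def
  have hm0 : 0 < m := by rw [hm_def]; linarith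
  set A : ℝ := ∑ k, a k ^ 2 with hA_def
  have hA0 : 0 ≤ A := Finset.sum_nonneg fun k _ ↦ sq_nonneg (a k)
  have hai : 0 < a i ^ 2 := by positivity
  set B : ℝ := s * A / m + 1 with hB_def
  have hB0 : 0 < B := by
    have : 0 ≤ s * A / m := div_nonneg (mul_nonneg hs.le hA0) hm0.le
    linarith
  set u : ℝ := min m (s * a i ^ 2 / B) with hu_def
  have hu0 : 0 < u := lt_min hm0 (div_pos (mul_pos hs hai) hB0)
  have hum : u ≤ m := min_le_left _ _
  have hBu : B ≤ s * a i ^ 2 / u := by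
    rw [le_div_iff₀ hu0]
    have : u ≤ s * a i ^ 2 / B := min_le_right _ _
    rw [le_div_iff₀ hB0] at this
    linarith
  -- at E i − u the sum is ≥ a_i²/u (all other terms ≥ 0 since every rung is ≥ E i > E i − u)
  have hhigh : 1 ≤ s * ∑ k, a k ^ 2 / (E k - (E i - u)) := by
    have hterm : a i ^ 2 / u ≤ ∑ k, a k ^ 2 / (E k - (E i - u)) := by
      rw [← Finset.add_sum_erase _ (fun k ↦ a k ^ 2 / (E k - (E i - u))) (Finset.mem_univ i)]
      have e : a i ^ 2 / (E i - (E i - u)) = a i ^ 2 / u := by rw [show E i - (E i - u) = u by ring]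
      rw [e]
      have : 0 ≤ ∑ k ∈ univ.erase i, a k ^ 2 / (E k - (E i - u)) :=
        Finset.sum_nonneg fun k _ ↦ div_nonneg (sq_nonneg _) (by linarith [hbot k])
      linarith
    have h' : s * (a i ^ 2 / u) ≤ s * ∑ k, a k ^ 2 / (E k - (E i - u)) := mul_le_mul_of_nonneg_left hterm hs.le
    have e : s * (a i ^ 2 / u) = s * a i ^ 2 / u := by ring
    rw [e] at h'
    have hsA : 0 ≤ s * A / m := div_nonneg (mul_nonneg hs.le hA0) hm0.le
    linarith
  have hle : lam0 ≤ E i - u := by linarith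
  have hcont : ContinuousOn (fun lam ↦ s * ∑ k, a k ^ 2 / (E k - lam)) (Set.Icc lam0 (E i - u)) := by
    refine continuousOn_secular_sum s (t := 1) one_pos hu0 fun k ↦ Or.inr (by linarith [hbot k])
  have hmem : (1 : ℝ) ∈ Set.Icc (s * ∑ k, a k ^ 2 / (E k - lam0)) (s * ∑ k, a k ^ 2 / (E k - (E i - u))) := ⟨hval0, hhigh⟩
  obtain ⟨lam, ⟨h1, h2⟩, hval⟩ := intermediate_value_Icc hle hcont hmem
  exact ⟨lam, h1, by linarith, hval⟩

end Summit.RiemannHypothesis.RiemannHypothesis.Theorems.HandoffSecularGaps
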